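import Literature.Computability.AlgebraicComplexity.GKSS19MainTheorem
import Literature.Computability.AlgebraicComplexity.GKSS19LowVariables
import HarnessLib

/-!
# Guo–Kumar–Saptharishi–Solomon 2019, Theorem 1.6: `GKSS2019_mainThm` holds

Cell `val-lit`, seat t19 (literature-prover): the DISCHARGE of the named fact
`Literature.Computability.AlgebraicComplexity.GKSS2019_mainThm` (AC/GKSS19HardnessToHittingSets.lean,
v2 with erratum A34 — the printed convention `s, D, n ≥ 1` made explicit) along the printed proof
of [GKSS19, §3]. The proof lives in the sibling files `AC/GKSS19{ShiftCalculus, Lemma24,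
PartialHomogenisation, Claim23, DerivativeCost, GridInterpolation, Nondegenerate, Preprocessing,
ReconstructionStep, ReconstructionTools, Reconstruction, MainTheorem, LowVariables}.lean`; this file
cannot be appended to the fact's own module (import cycle), hence the `…Holds` sibling.
THEOREM-ONLY; nothing here bears on `VP ≠ VNP`, which is NOT proved — this is a formalisation of a
published 2019 theorem (hardness-to-pseudorandomness for algebraic circuits of few variables).

Source: Z. Guo, M. Kumar, R. Saptharishi, N. Solomon, *Derandomization from algebraic hardness*,
SIAM J. Comput. 51 (2022) = arXiv:1905.00091 [GuoKumarSaptharishiSolomon2019], Theorem 1.6 /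
‹G_P is an HSG› (held text `paper:arxiv-1905.00091`, p0006.txt:L52–57) with its proof §3
(p0011–p0012).

## References
* [GuoKumarSaptharishiSolomon2019] arXiv:1905.00091, Thm 1.6 (p0006.txt:L52-57), §3.
-/

noncomputable section

namespace Literature.Computability.AlgebraicComplexity

/-- **GKSS Theorem 1.6 (`G_P` is a hitting-set generator for `𝒞(n+1, D, s)` when `P` is hard),
discharged** with the absolute constant `c = 15`: the §3 chain (`GKSS2019.mainThm_of_lowVariables`)
together with the low-variable case (`GKSS2019.lowVariables`).
[cite: GuoKumarSaptharishiSolomon2019, Thm 1.6 (arXiv p0006.txt:L52-57), proof §3 (p0011-p0012)] -/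
theorem GKSS2019_mainThm_holds : GKSS2019_mainThm :=
  GKSS2019.mainThm_of_lowVariables GKSS2019.lowVariables

end Literature.Computability.AlgebraicComplexity
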